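import Summits.BirchSwinnertonDyer.BirchSwinnertonDyer.Theorems.KolyvaginDepthDoorDepthTableRowKitPrint
import Summits.BirchSwinnertonDyer.BirchSwinnertonDyer.Theorems.KolyvaginDepthDoorKolyvaginDepthSupplyMinimalDepth
import HarnessLib

/-!
# Route `KolyvaginDepthDoor` — the VANISHING ROW KIT: bit-free depth-table rows BELOW the points, on
# (γ) [Gross 1991 Prop. 3.7 (2)] + a Kodaira–Néron certificate read off the integer model
# (crux `KolyvaginDepthSupply`, stmt-BirchSwinnertonDyer-21765)

Helper file (`--supports stmt-BirchSwinnertonDyer-21765 --as helper`); it closes nothing and BSD is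
not proved by it.

Every depth-table row of g2–g8 has the shape «bit `c_1(n) ≠ 0` at depth `ν = rank − 1` ⟹ `t_p = 0`».
The bit-free lower bound of `…KolyvaginDepthSupplyMinimalDepth` (this seat:
`kolyvaginClass_eq_zero_of_rank_of_datum_kodairaNeron` — a non-zero level-1 class of depth `ν` forces
`rank E(ℚ) ≤ ν + 1`) adds a second row shape, with NO computed input at all: «depth `ν ≤ rank − 2` ⟹
`c_1(n) = 0` for EVERY datum of conductor `n`». These are falsifiable PREDICTIONS of the instrument
(JLS-computable: `c_1(ℓ) = 0` iff the derived point `P_ℓ` is divisible by `p` in `E(K[ℓ])` modulo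
torsion, McCallum Cor. 4.5), conditional on (γ) only on the Kodaira–Néron cell:

* `depthRowOne_vanishes_printKN_of_intModel_certificate` — rank `≥ 3`, ONE certified Kolyvagin prime
  `ℓ`: every datum of conductor `ℓ` has `c_1(ℓ) = 0`;
* `depthRowZero_vanishes_printKN_of_intModel_certificate` — rank `≥ 2`: every datum of conductor `1`
  has `c_1(1) = 0` (the class of `y_K` dies mod `p`; consistent with `y_K` torsion at analytic rank
  `≥ 2`, here obtained with no `L`-function);
* `…_print_of_intModel_certificate_gross1991E0` (both depths) — the same off the Kodaira–Néron cell,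
  modulo (γ) + F1 = `Gross1991_heegnerPoint_sub_ratTorsion_mem_E0`.

Inputs: g7's integer-model certificate interface (`isKolyvaginPrime_of_intModel_certificate`,
`satisfiesHeegnerHypothesis_conductorNorm_of_intModel`, the `decide`-able (KN_p) table
`not_dvd_ordMinimalDiscriminant_of_intModel_table`), (γ) = `GrossLMS1991.prop37_2_frobeniusCongruence`.
CONDITIONAL on (γ); per-curve; BSD is not proved by it.

References: [Kolyvagin1991MathAnn] Thm. 2.3, Thm. 4; [GrossLMS1991] Prop. 3.7 (2), §10;
[McCallumLMS1991] §4 Cor. 4.5, §5; [JetchevLauterStein2009] §3 (arXiv:0707.0032); [SilvermanAEC2009] VII.6.1.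
-/

set_option linter.dupNamespace false

noncomputable section

open scoped Classical NumberField

namespace Summit.BirchSwinnertonDyer.BirchSwinnertonDyer.Theorems.KolyvaginDepthDoor

open Literature.NumberTheory.EllipticCurves Literature.NumberTheory.EllipticCurves.ModularForms
  Literature.NumberTheory.EllipticCurves.McCallum1991 WeierstrassCurve NumberField IsDedekindDomain
open Literature.NumberTheory.DiophantineGeometry (KodairaSymbol)

section Generic

variable {W : WeierstrassCurve ℚ} [W.IsElliptic] [W.IsGloballyMinimal] {E₀ : WeierstrassCurve ℤ}
  (hI : integralModelInt W = E₀)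
include hI

/-- **Depth-ONE vanishing row off an integer model (rank `≥ 3`), on (γ) + a Kodaira–Néron certificate —
NO bit.** Inputs: g7's integer-model certificate of ONE Kolyvagin prime `ℓ` (`ℓ ∤ 2Δ D p`,
`(D/ℓ) = −1`, `p ∣ ℓ + 1`, `p ∣ ℓ + 1 − #Ẽ(𝔽_ℓ)`), `3 ≤ rank E(ℚ)`, `p` odd with the tower surjectivity,
`K` imaginary quadratic with `d_K = D ∉ {−3, −4}` Heegner for `Δ(E₀)`, the `decide`-able (KN_p) table,
(γ). Output: for ANY frame `(Dt, β, ι)` and ANY datum `d` of conductor `ℓ`, `c_1(ℓ) = 0` — a class of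
depth `1 ≤ rank − 2` dies (`kolyvaginClass_eq_zero_of_rank_of_datum_kodairaNeron`). CONDITIONAL on (γ);
per-curve; BSD is not proved by it. [cite: Kolyvagin1991MathAnn, Thm. 2.3 and Thm. 4]
[cite: GrossLMS1991, Prop. 3.7 (2), Prop. 6.2 (1), §10] [cite: McCallumLMS1991, §4 Cor. 4.5]
[cite: SilvermanAEC2009, VII.6.1] [cite: WZhang2014, Notations (xii)] -/
theorem depthRowOne_vanishes_printKN_of_intModel_certificate
    (h372 : GrossLMS1991.prop37_2_frobeniusCongruence)
    (hcm : ¬ W.HasCM) (hr : 3 ≤ W.mordellWeilRank)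
    (p : ℕ) [hp : Fact p.Prime] (hp2 : p ≠ 2)
    (htower : ∀ n : ℕ, W.HasSurjectiveModNGaloisRep (p ^ n : ℕ))
    (K : Type) [Field K] [NumberField K] (hK : IsImaginaryQuadratic K) {D : ℤ}
    (hD : NumberField.discr K = D) (h3 : D ≠ -3) (h4 : D ≠ -4)
    (hH : ∀ q : ℕ, q.Prime → (q : ℤ) ∣ E₀.Δ → (q = 2 → D % 8 = 1) ∧ (q ≠ 2 → jacobiSym D q = 1))
    (ℓ : ℕ) (hℓ : ℓ.Prime) (hℓ2 : ℓ ≠ 2) (hℓΔ : ¬ (ℓ : ℤ) ∣ E₀.Δ) (hℓD : ¬ (ℓ : ℤ) ∣ D)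
    (hℓp : ℓ ≠ p) (hjac : jacobiSym D ℓ = -1) (hℓ1 : p ∣ ℓ + 1) {n : ℕ}
    (hcard : Nat.card ((E₀.map (Int.castRingHom (ZMod ℓ))).toAffine.Point) = n)
    (haℓ : (p : ℤ) ∣ (ℓ : ℤ) + 1 - n)
    {Δ₀ : ℤ} (hΔ : E₀.Δ = Δ₀) {B : ℕ} (hB : Δ₀.natAbs < B ^ p)
    (htab : ∀ q ∈ Finset.range B, q.Prime → q ∣ Δ₀.natAbs →
      ∃ e ∈ Finset.range 64, q ^ e ∣ Δ₀.natAbs ∧ ¬ q ^ (e + 1) ∣ Δ₀.natAbs ∧ ¬ p ∣ e)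
    (hadd : ∀ v : HeightOneSpectrum (𝓞 ℚ), W.HasAdditiveReductionAt v → p ≠ 3 ∨
      (W.kodairaSymbolAt v ≠ KodairaSymbol.IV ∧ W.kodairaSymbolAt v ≠ KodairaSymbol.IVstar))
    [NeZero (W.conductorNorm ℤ)] (Dt : ModularParametrizationData W (W.conductorNorm ℤ)) (β : ℤ)
    (ι : K →+* ℂ) (d : KolyvaginHeegnerData Dt β ι ℓ) :
    d.kolyvaginClass hp.out 1 = 0 := by
  obtain ⟨hkol, -⟩ := isKolyvaginPrime_of_intModel_certificate hI p K hK.1 hD ℓ hℓ hℓ2 hℓΔ hℓD hℓp hjac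
    hℓ1 hcard haℓ
  obtain ⟨c, hc, hcc⟩ := exists_conj_of_isImaginaryQuadratic K hK
  have hH' := satisfiesHeegnerHypothesis_conductorNorm_of_intModel hI K hK.1 hD hH
  have hmult : ∀ v : HeightOneSpectrum (𝓞 ℚ), W.HasMultiplicativeReductionAt v →
      ¬ p ∣ W.ordMinimalDiscriminant v :=
    not_dvd_ordMinimalDiscriminant_of_intModel_table hI hΔ hB htab
  have hcard1 : ℓ.primeFactors.card = 1 := by rw [hℓ.primeFactors, Finset.card_singleton]
  exact kolyvaginClass_eq_zero_of_rank_of_datum_kodairaNeron h372 hcm hK (by rw [hD]; exact h3)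
    (by rw [hD]; exact h4) hH' p hp2 htower c hc hcc hmult hadd hℓ.squarefree
    (fun q hq ↦ by
      rw [hℓ.primeFactors, Finset.mem_singleton] at hq
      exact hq ▸ hkol) d (Or.inl (by rw [hcard1]; exact hr))

/-- **Depth-ZERO vanishing row off an integer model (rank `≥ 2`), on (γ) + a Kodaira–Néron certificate
— NO bit.** Inputs as above minus the Kolyvagin prime: `2 ≤ rank E(ℚ)`. Output: for ANY frame and ANY
datum `d` of conductor `1`, `c_1(1) = 0` — the class of the Heegner point `y_K = P(1)` dies in
`H¹(K, E[p])` (`kolyvaginClass_eq_zero_of_rank_of_datum_kodairaNeron` at `n = 1`, `ν = 0 ≤ rank − 2`).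
CONDITIONAL on (γ); per-curve; BSD is not proved by it. [cite: Kolyvagin1991MathAnn, Thm. 2.3 and Thm. 4]
[cite: GrossLMS1991, Prop. 3.7 (2), §4 (P_1 = y_K), §10] [cite: SilvermanAEC2009, VII.6.1] -/
theorem depthRowZero_vanishes_printKN_of_intModel_certificate
    (h372 : GrossLMS1991.prop37_2_frobeniusCongruence)
    (hcm : ¬ W.HasCM) (hr : 2 ≤ W.mordellWeilRank)
    (p : ℕ) [hp : Fact p.Prime] (hp2 : p ≠ 2)
    (htower : ∀ n : ℕ, W.HasSurjectiveModNGaloisRep (p ^ n : ℕ))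
    (K : Type) [Field K] [NumberField K] (hK : IsImaginaryQuadratic K) {D : ℤ}
    (hD : NumberField.discr K = D) (h3 : D ≠ -3) (h4 : D ≠ -4)
    (hH : ∀ q : ℕ, q.Prime → (q : ℤ) ∣ E₀.Δ → (q = 2 → D % 8 = 1) ∧ (q ≠ 2 → jacobiSym D q = 1))
    {Δ₀ : ℤ} (hΔ : E₀.Δ = Δ₀) {B : ℕ} (hB : Δ₀.natAbs < B ^ p)
    (htab : ∀ q ∈ Finset.range B, q.Prime → q ∣ Δ₀.natAbs →
      ∃ e ∈ Finset.range 64, q ^ e ∣ Δ₀.natAbs ∧ ¬ q ^ (e + 1) ∣ Δ₀.natAbs ∧ ¬ p ∣ e)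
    (hadd : ∀ v : HeightOneSpectrum (𝓞 ℚ), W.HasAdditiveReductionAt v → p ≠ 3 ∨
      (W.kodairaSymbolAt v ≠ KodairaSymbol.IV ∧ W.kodairaSymbolAt v ≠ KodairaSymbol.IVstar))
    [NeZero (W.conductorNorm ℤ)] (Dt : ModularParametrizationData W (W.conductorNorm ℤ)) (β : ℤ)
    (ι : K →+* ℂ) (d : KolyvaginHeegnerData Dt β ι 1) :
    d.kolyvaginClass hp.out 1 = 0 := by
  obtain ⟨c, hc, hcc⟩ := exists_conj_of_isImaginaryQuadratic K hK
  have hH' := satisfiesHeegnerHypothesis_conductorNorm_of_intModel hI K hK.1 hD hH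
  have hmult : ∀ v : HeightOneSpectrum (𝓞 ℚ), W.HasMultiplicativeReductionAt v →
      ¬ p ∣ W.ordMinimalDiscriminant v :=
    not_dvd_ordMinimalDiscriminant_of_intModel_table hI hΔ hB htab
  exact kolyvaginClass_eq_zero_of_rank_of_datum_kodairaNeron h372 hcm hK (by rw [hD]; exact h3)
    (by rw [hD]; exact h4) hH' p hp2 htower c hc hcc hmult hadd squarefree_one
    (fun q hq ↦ by simp [Nat.primeFactors_one] at hq) d
    (Or.inl (by rw [Nat.primeFactors_one, Finset.card_empty]; exact hr))

/-- **Depth-ONE vanishing row off an integer model (rank `≥ 3`) in general, modulo (γ) + F1** (F1 =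
`Gross1991_heegnerPoint_sub_ratTorsion_mem_E0`, [GZ86 III (3.1)]; no Kodaira–Néron certificate needed):
for ANY frame and ANY datum `d` of conductor `ℓ`, `c_1(ℓ) = 0`
(`kolyvaginClass_eq_zero_of_rank_of_datum_gross1991E0`). CONDITIONAL on (γ) + F1; per-curve; BSD is not
proved by it. [cite: Kolyvagin1991MathAnn, Thm. 2.3 and Thm. 4] [cite: GrossLMS1991, Prop. 3.7 (2), Prop. 6.2 (1), §10]
[cite: GrossZagier1986, III (3.1)] -/
theorem depthRowOne_vanishes_print_of_intModel_certificate_gross1991E0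
    (h372 : GrossLMS1991.prop37_2_frobeniusCongruence)
    (hE0 : Gross1991_heegnerPoint_sub_ratTorsion_mem_E0)
    (hcm : ¬ W.HasCM) (hr : 3 ≤ W.mordellWeilRank)
    (p : ℕ) [hp : Fact p.Prime] (hp2 : p ≠ 2)
    (htower : ∀ n : ℕ, W.HasSurjectiveModNGaloisRep (p ^ n : ℕ))
    (K : Type) [Field K] [NumberField K] (hK : IsImaginaryQuadratic K) {D : ℤ}
    (hD : NumberField.discr K = D) (h3 : D ≠ -3) (h4 : D ≠ -4)
    (hH : ∀ q : ℕ, q.Prime → (q : ℤ) ∣ E₀.Δ → (q = 2 → D % 8 = 1) ∧ (q ≠ 2 → jacobiSym D q = 1))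
    (ℓ : ℕ) (hℓ : ℓ.Prime) (hℓ2 : ℓ ≠ 2) (hℓΔ : ¬ (ℓ : ℤ) ∣ E₀.Δ) (hℓD : ¬ (ℓ : ℤ) ∣ D)
    (hℓp : ℓ ≠ p) (hjac : jacobiSym D ℓ = -1) (hℓ1 : p ∣ ℓ + 1) {n : ℕ}
    (hcard : Nat.card ((E₀.map (Int.castRingHom (ZMod ℓ))).toAffine.Point) = n)
    (haℓ : (p : ℤ) ∣ (ℓ : ℤ) + 1 - n)
    [NeZero (W.conductorNorm ℤ)] (Dt : ModularParametrizationData W (W.conductorNorm ℤ)) (β : ℤ)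
    (ι : K →+* ℂ) (d : KolyvaginHeegnerData Dt β ι ℓ) :
    d.kolyvaginClass hp.out 1 = 0 := by
  obtain ⟨hkol, -⟩ := isKolyvaginPrime_of_intModel_certificate hI p K hK.1 hD ℓ hℓ hℓ2 hℓΔ hℓD hℓp hjac
    hℓ1 hcard haℓ
  obtain ⟨c, hc, hcc⟩ := exists_conj_of_isImaginaryQuadratic K hK
  have hH' := satisfiesHeegnerHypothesis_conductorNorm_of_intModel hI K hK.1 hD hH
  have hcard1 : ℓ.primeFactors.card = 1 := by rw [hℓ.primeFactors, Finset.card_singleton]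
  exact kolyvaginClass_eq_zero_of_rank_of_datum_gross1991E0 h372 hE0 hcm hK (by rw [hD]; exact h3)
    (by rw [hD]; exact h4) hH' p hp2 htower c hc hcc hℓ.squarefree
    (fun q hq ↦ by
      rw [hℓ.primeFactors, Finset.mem_singleton] at hq
      exact hq ▸ hkol) d (Or.inl (by rw [hcard1]; exact hr))

/-- **Depth-ZERO vanishing row off an integer model (rank `≥ 2`) in general, modulo (γ) + F1**: for ANY
frame and ANY datum `d` of conductor `1`, `c_1(1) = 0`. CONDITIONAL on (γ) + F1; per-curve; BSD is not
proved by it. [cite: Kolyvagin1991MathAnn, Thm. 2.3 and Thm. 4] [cite: GrossLMS1991, Prop. 3.7 (2), §4, §10]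
[cite: GrossZagier1986, III (3.1)] -/
theorem depthRowZero_vanishes_print_of_intModel_certificate_gross1991E0
    (h372 : GrossLMS1991.prop37_2_frobeniusCongruence)
    (hE0 : Gross1991_heegnerPoint_sub_ratTorsion_mem_E0)
    (hcm : ¬ W.HasCM) (hr : 2 ≤ W.mordellWeilRank)
    (p : ℕ) [hp : Fact p.Prime] (hp2 : p ≠ 2)
    (htower : ∀ n : ℕ, W.HasSurjectiveModNGaloisRep (p ^ n : ℕ))
    (K : Type) [Field K] [NumberField K] (hK : IsImaginaryQuadratic K) {D : ℤ}
    (hD : NumberField.discr K = D) (h3 : D ≠ -3) (h4 : D ≠ -4)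
    (hH : ∀ q : ℕ, q.Prime → (q : ℤ) ∣ E₀.Δ → (q = 2 → D % 8 = 1) ∧ (q ≠ 2 → jacobiSym D q = 1))
    [NeZero (W.conductorNorm ℤ)] (Dt : ModularParametrizationData W (W.conductorNorm ℤ)) (β : ℤ)
    (ι : K →+* ℂ) (d : KolyvaginHeegnerData Dt β ι 1) :
    d.kolyvaginClass hp.out 1 = 0 := by
  obtain ⟨c, hc, hcc⟩ := exists_conj_of_isImaginaryQuadratic K hK
  have hH' := satisfiesHeegnerHypothesis_conductorNorm_of_intModel hI K hK.1 hD hH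
  exact kolyvaginClass_eq_zero_of_rank_of_datum_gross1991E0 h372 hE0 hcm hK (by rw [hD]; exact h3)
    (by rw [hD]; exact h4) hH' p hp2 htower c hc hcc squarefree_one
    (fun q hq ↦ by simp [Nat.primeFactors_one] at hq) d
    (Or.inl (by rw [Nat.primeFactors_one, Finset.card_empty]; exact hr))

end Generic

end Summit.BirchSwinnertonDyer.BirchSwinnertonDyer.Theorems.KolyvaginDepthDoor

end
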